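import Literature.Analysis.FluidPDE.ConfinedHardSphereFlowAlexander
import HarnessLib

/-!
# Existence of the confined hard-sphere flow on the torus among round scatterers (discharge)

Discharge of the named fact `ConfinedHardSphereFlow.nonempty_torus_balls` of
`Literature.Analysis.FluidPDE.ConfinedHardSphereFlow` (Cercignani–Illner–Pulvirenti 1994,
Thm. 4.2.1 with App. 4.A p. 111: "The cases of reflecting boundary conditions […] can be treated
similarly"; Alexander 1975): for spheres of diameter `0 < ε < 1/2` on the flat torus `T^d`,
finitely many round scatterers of exclusion radius `ρ = R + ε/2 < 1/2` with `2ρ < dist(a, a')`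
for distinct centres, and every `N`, the hypothesis structure `ConfinedHardSphereFlow` is
inhabited — by the event-by-event flow `ConfinedAlexander.flow` with good set
`ConfinedAlexander.good` (`ConfinedHardSphereFlowConstruction`), whose five property clusters are
proved in `ConfinedHardSphereFlow{Orbits,Group,Measurable,Alexander}` (orbits are confined
trajectories; group on the invariant good set; measurability; the bad set is null; Liouville).

## References

* C. Cercignani, R. Illner, M. Pulvirenti, *The Mathematical Theory of Dilute Gases*, Springer
  (1994), §4.2 pp. 64–66 (Thm. 4.2.1), App. 4.A pp. 107–111 (p. 111).
* R. K. Alexander, *The infinite hard sphere system*, Ph.D. thesis, UC Berkeley (1975).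
-/

namespace Literature.Analysis.FluidPDE

noncomputable section

variable {d : Type*} [Fintype d]

/-- **Existence of the confined hard-sphere flow on the flat torus among finitely many separated
round scatterers** — discharge of `ConfinedHardSphereFlow.nonempty_torus_balls` (CIP 1994
Thm. 4.2.1 with App. 4.A p. 111; Alexander 1975): `ConfinedAlexander.exists_confinedHardSphereFlow`
with centres `ctr = Subtype.val : c → T^d` and exclusion radius `ρ = R + ε/2`.
[cite: CIP1994, Thm. 4.2.1 and App. 4.A p. 111] [cite: Alexander1975] -/
theorem ConfinedHardSphereFlow.nonempty_torus_balls_holds : ConfinedHardSphereFlow.nonempty_torus_balls (d := d) := by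
  intro ε R hε hε' hR hρ c hsep N
  exact ConfinedAlexander.exists_confinedHardSphereFlow (ctr := fun a : c => (a : UnitAddTorus d))
    (add_pos_of_nonneg_of_pos hR (half_pos hε)) hε hε' hρ
    (fun k l hkl => hsep k k.2 l l.2 fun h => hkl (Subtype.ext h)) N

end

end Literature.Analysis.FluidPDE
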